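import Literature.RepresentationTheory.CompactGroups.MatrixGroupExpSurjective
import Literature.AlgebraicTopology.FundamentalGroup.CompactManifoldFundamentalGroupFG
import Literature.AlgebraicTopology.Homotopy.ManifoldStronglyLocallyContractible
import HarnessLib

/-!
# A compact group with a faithful representation is a topological manifold

Topic `Literature/RepresentationTheory/CompactGroups`.  A compact topological group `G` with a
faithful (injective) continuous finite-dimensional representation `ρ` is a closed subgroup of
`GL_N(ℂ)` — after Weyl's unitarian trick (`unitarize`, `UnitaryTrick.lean`) a closed subgroup
`S` of `U(N)` — hence a Lie group (T. Bröcker, T. tom Dieck, *Representations of Compact Lie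
Groups* (1985), I (3.11): closed subgroups are Lie subgroups, proved via von Neumann's theorem;
III (4.1)–(4.2) conversely).  Mathlib has no Lie-group structure on closed matrix groups; the
tree's `MatrixGroupExpSurjective.lean` proves von Neumann's theorem in the form
`MatrixLie.exists_chart`: near `1`, `S` is the homeomorphic image of a neighbourhood of `0` in its
Lie algebra `L(S)` under `exp`, with inverse the matrix logarithm `mlog`.  Here we draw the
TOPOLOGICAL consequences needed by the universal-cover argument for
`CompactSemisimpleUniversalCover`:

* `MatrixLie.exists_openPartialHomeomorph_one_mem`, `MatrixLie.exists_chartedSpace` — for an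
  injective continuous homomorphism `σ` of `G` onto a closed unitary group `S`, **`G` is a
  topological manifold modelled on the finite-dimensional real normed space `L(S)`**: an explicit
  `ChartedSpace (L(S)) G` whose chart at `x` is `y ↦ log σ(x⁻¹ y)`, stated as `Nonempty`.
* **`MatrixLie.topology_of_faithful`** — a compact connected `G` with a faithful continuous
  representation is Hausdorff, path connected, strongly locally contractible (the tree's
  `stronglyLocallyContractibleSpace_of_chartedSpace_normedSpace`, Hatcher Cor. A.9; see also the
  independent `MatrixGroupLocallyContractible.lean`), and its fundamental group is finitely
  generated (the tree's `fundamentalGroup_fg_of_compactSpace_chartedSpace`, Hatcher Thm. 1.20 /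
  Lee Thm. 7.21).

Everything here is proved; there are no definitions (the charted-space structure is produced
inside the proofs) and no named facts.

## References

* T. Bröcker, T. tom Dieck, *Representations of Compact Lie Groups*, GTM 98, Springer 1985,
  I (3.11), III (4.1). [BrockerTomDieck1985]
* A. Hatcher, *Algebraic Topology*, CUP 2002, Thm. 1.20, Cor. A.9. [HatcherAT2002]
-/

noncomputable section

open scoped Matrix.Norms.Operator ComplexOrder Manifold
open NormedSpace Matrix Topology Filter Set

namespace Literature.RepresentationTheory.CompactGroups

namespace MatrixLie

open Literature.RepresentationTheory.CompactGroups.CompactGroup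
open Literature.AlgebraicTopology.FundamentalGroup Literature.AlgebraicTopology.Homotopy

variable {G : Type*} [Group G] [TopologicalSpace G] [IsTopologicalGroup G] [CompactSpace G]

omit [IsTopologicalGroup G] in
/-- **The chart of a closed unitary group near `1`, transported to `G`.**  For an injective
continuous homomorphism `σ : G →* M_N(ℂ)` of the compact group `G` onto a closed unitary group
`S = σ(G)` there is an `OpenPartialHomeomorph` from `G` to the Lie algebra `L(S)` with `1` in
its source: `x ↦ log σ(x)` with inverse `X ↦ σ⁻¹ (exp X)` (von Neumann's theorem,
`MatrixLie.exists_chart`; Bröcker–tom Dieck I (3.11)). [cite: BrockerTomDieck1985, I (3.11)] -/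
theorem exists_openPartialHomeomorph_one_mem {N : Type*} [Fintype N] [DecidableEq N]
    (σ : G →* Matrix N N ℂ) (hσc : Continuous σ) (hσinj : Function.Injective σ)
    (hS : IsClosedUnitaryGroup (Set.range σ)) :
    ∃ φ : OpenPartialHomeomorph G (lieAlg hS), (1 : G) ∈ φ.source := by
  classical
  set L := lieAlg hS with hL
  haveI : T2Space G := (hσc.isClosedEmbedding hσinj).isEmbedding.t2Space
  -- a continuous linear projection onto `L`
  obtain ⟨Q, hQ⟩ := L.exists_isCompl
  let P : Matrix N N ℂ →ₗ[ℝ] L := Submodule.projectionOnto L Q hQ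
  have hP : ∀ X : L, P X = X := fun X => Submodule.projectionOnto_apply_left hQ X
  have hPc : Continuous P := P.continuous_of_finiteDimensional
  -- the exponential chart of `M_N(ℂ)` at `0` and the matrix logarithm `mlog = e.symm`
  set e := (hasStrictFDerivAt_exp_zero_equiv (ι := N)).toOpenPartialHomeomorph exp with he
  have hmlog : (mlog : Matrix N N ℂ → Matrix N N ℂ) = e.symm := rfl
  have he_coe : (e : Matrix N N ℂ → Matrix N N ℂ) = exp :=
    (hasStrictFDerivAt_exp_zero_equiv (ι := N)).toOpenPartialHomeomorph_coe
  have h0 : (0 : Matrix N N ℂ) ∈ e.source :=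
    (hasStrictFDerivAt_exp_zero_equiv (ι := N)).mem_toOpenPartialHomeomorph_source
  have h1 : (1 : Matrix N N ℂ) ∈ e.target := by
    have := e.map_source h0
    rwa [he_coe, exp_zero] at this
  obtain ⟨δ, hδ, hball⟩ := Metric.isOpen_iff.1 e.open_target 1 h1
  obtain ⟨ε, hε, hchart⟩ := exists_chart hS
  set r := min ε δ with hr
  have hr0 : 0 < r := lt_min hε hδ
  -- the homeomorphism `G ≃ₜ S`
  have hemb : IsClosedEmbedding σ := hσc.isClosedEmbedding hσinj
  let eσ : G ≃ₜ Set.range σ := hemb.isEmbedding.toHomeomorph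
  have heσ : ∀ x, (eσ x : Matrix N N ℂ) = σ x := fun x => rfl
  have heσ_symm : ∀ y : Set.range σ, σ (eσ.symm y) = y := fun y => by
    have h := congrArg Subtype.val (eσ.apply_symm_apply y)
    exact h
  -- facts on the source
  have hsrc : ∀ x : G, dist (σ x) 1 < r →
      mlog (σ x) ∈ L ∧ exp (mlog (σ x)) = σ x ∧ σ x ∈ e.target := fun x hx =>
    ⟨(hchart (σ x) ⟨x, rfl⟩ (hx.trans_le (min_le_left _ _))).1,
      (hchart (σ x) ⟨x, rfl⟩ (hx.trans_le (min_le_left _ _))).2,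
      hball (hx.trans_le (min_le_right _ _))⟩
  have hPval : ∀ {X : Matrix N N ℂ} (hX : X ∈ L), (P X : Matrix N N ℂ) = X := fun {X} hX =>
    congrArg Subtype.val (hP ⟨X, hX⟩)
  refine ⟨{ toFun := fun x => P (mlog (σ x))
            invFun := fun X => eσ.symm ⟨exp (X : Matrix N N ℂ), exp_mem_of_mem_lieSet X.2⟩
            source := {x | dist (σ x) 1 < r}
            target := {X | (X : Matrix N N ℂ) ∈ e.source ∧ dist (exp (X : Matrix N N ℂ)) 1 < r}
            map_source' := fun x hx => by
              obtain ⟨hmem, hexp, htgt⟩ := hsrc x hx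
              refine ⟨?_, ?_⟩
              · show (P (mlog (σ x)) : Matrix N N ℂ) ∈ e.source
                rw [hPval hmem, hmlog]
                exact e.map_target htgt
              · show dist (exp (P (mlog (σ x)) : Matrix N N ℂ)) 1 < r
                rw [hPval hmem, hexp]
                exact hx
            map_target' := by
              rintro X ⟨-, hXd⟩
              show dist (σ (eσ.symm ⟨exp (X : Matrix N N ℂ), _⟩)) 1 < r
              rw [heσ_symm]
              exact hXd
            left_inv' := fun x hx => by
              obtain ⟨hmem, hexp, -⟩ := hsrc x hx
              show eσ.symm ⟨exp (P (mlog (σ x)) : Matrix N N ℂ), _⟩ = x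
              apply eσ.injective
              rw [eσ.apply_symm_apply]
              apply Subtype.ext
              rw [heσ]
              show exp (P (mlog (σ x)) : Matrix N N ℂ) = σ x
              rw [hPval hmem, hexp]
            right_inv' := by
              rintro X ⟨hXs, -⟩
              show P (mlog (σ (eσ.symm ⟨exp (X : Matrix N N ℂ), _⟩))) = X
              rw [heσ_symm]
              show P (mlog (exp (X : Matrix N N ℂ))) = X
              have : mlog (exp (X : Matrix N N ℂ)) = X := by
                rw [hmlog, ← he_coe]
                exact e.left_inv hXs
              rw [this]
              exact hP X
            open_source := isOpen_lt (continuous_dist.comp (hσc.prodMk continuous_const))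
              continuous_const
            open_target := (e.open_source.preimage continuous_subtype_val).inter
              (isOpen_lt (continuous_dist.comp
                ((exp_continuous.comp continuous_subtype_val).prodMk continuous_const))
                continuous_const)
            continuousOn_toFun := by
              show ContinuousOn (fun x => P (mlog (σ x))) {x | dist (σ x) 1 < r}
              refine hPc.comp_continuousOn ?_
              rw [hmlog]
              exact e.continuousOn_symm.comp hσc.continuousOn fun x hx => (hsrc x hx).2.2
            continuousOn_invFun :=
              (eσ.symm.continuous.comp ((exp_continuous.comp continuous_subtype_val).subtype_mk
                fun X => exp_mem_of_mem_lieSet X.2)).continuousOn }, ?_⟩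
  show dist (σ 1) 1 < r
  rw [map_one, dist_self]
  exact hr0

/-- **A compact group with a faithful representation is a topological manifold** modelled on
the Lie algebra `L(S)` of its unitarised image `S` (a finite-dimensional real normed space):
translate the chart at `1` by left multiplication (Bröcker–tom Dieck I (3.11)).
[cite: BrockerTomDieck1985, I (3.11)] -/
theorem exists_chartedSpace {N : Type*} [Fintype N] [DecidableEq N]
    (σ : G →* Matrix N N ℂ) (hσc : Continuous σ) (hσinj : Function.Injective σ)
    (hS : IsClosedUnitaryGroup (Set.range σ)) : Nonempty (ChartedSpace (lieAlg hS) G) := by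
  obtain ⟨φ, hφ⟩ := exists_openPartialHomeomorph_one_mem σ hσc hσinj hS
  let chart : G → OpenPartialHomeomorph G (lieAlg hS) := fun x =>
    (Homeomorph.mulLeft x⁻¹).toOpenPartialHomeomorph.trans φ
  exact ⟨{ atlas := Set.range chart
           chartAt := chart
           mem_chart_source := fun x => by
             simp only [chart, OpenPartialHomeomorph.trans_source,
               Homeomorph.toOpenPartialHomeomorph_source, Set.univ_inter, Set.mem_preimage,
               Homeomorph.toOpenPartialHomeomorph_apply, Homeomorph.coe_mulLeft, inv_mul_cancel]
             exact hφ
           chart_mem_atlas := fun x => ⟨x, rfl⟩ }⟩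

/-- **Topological consequences of a faithful representation** (of the Lie-group structure of a
closed subgroup of `U(N)`, Bröcker–tom Dieck I (3.11)): a compact connected topological group
with an injective continuous finite-dimensional representation is Hausdorff, path connected and
strongly locally contractible, and its fundamental group is finitely generated (Hatcher 2002,
Cor. A.9 and Thm. 1.20 for compact manifolds; the tree's
`stronglyLocallyContractibleSpace_of_chartedSpace_normedSpace` and
`fundamentalGroup_fg_of_compactSpace_chartedSpace`). [cite: BrockerTomDieck1985, I (3.11)] -/
theorem topology_of_faithful [ConnectedSpace G] (N : ℕ) (ρ : G →* Matrix (Fin N) (Fin N) ℂ)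
    (hρ : Continuous ρ) (hinj : Function.Injective ρ) :
    T2Space G ∧ PathConnectedSpace G ∧ StronglyLocallyContractibleSpace G ∧
      Group.FG (FundamentalGroup G (1 : G)) := by
  classical
  -- unitarise
  set σ := unitarize ρ hρ with hσ
  have hσc : Continuous σ := continuous_unitarize ρ hρ
  have hB := isUnit_det_unitarizer ρ hρ
  have hσinj : Function.Injective σ := by
    intro a b h
    apply hinj
    have key : ∀ g, ρ g = (unitarizer ρ hρ)⁻¹ * σ g * unitarizer ρ hρ := fun g => by
      rw [hσ, unitarize_apply, show (unitarizer ρ hρ)⁻¹ * (unitarizer ρ hρ * ρ g * (unitarizer ρ hρ)⁻¹) *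
          unitarizer ρ hρ = ((unitarizer ρ hρ)⁻¹ * unitarizer ρ hρ) * ρ g *
          ((unitarizer ρ hρ)⁻¹ * unitarizer ρ hρ) by simp only [Matrix.mul_assoc],
        Matrix.nonsing_inv_mul _ hB, Matrix.one_mul, Matrix.mul_one]
    rw [key a, key b, h]
  have hS : IsClosedUnitaryGroup (Set.range σ) :=
    { one_mem := ⟨1, map_one σ⟩
      mul_mem := by rintro _ _ ⟨a, rfl⟩ ⟨b, rfl⟩; exact ⟨a * b, map_mul σ a b⟩
      star_mem := by
        rintro _ ⟨a, rfl⟩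
        refine ⟨a⁻¹, ?_⟩
        rw [hσ, unitarize_inv, Matrix.star_eq_conjTranspose]
      mem_unitary := by rintro _ ⟨a, rfl⟩; exact unitarize_mem_unitaryGroup ρ hρ a
      isClosed := (isCompact_range hσc).isClosed }
  haveI : T2Space G := (hσc.isClosedEmbedding hσinj).isEmbedding.t2Space
  obtain ⟨cs⟩ := exists_chartedSpace σ hσc hσinj hS
  haveI : StronglyLocallyContractibleSpace G :=
    @stronglyLocallyContractibleSpace_of_chartedSpace_normedSpace (lieAlg hS) _ _ G _ cs
  haveI : LocallyPathConnectedSpace G := inferInstance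
  exact ⟨inferInstance, PathConnectedSpace.of_locallyPathConnectedSpace, inferInstance,
    @fundamentalGroup_fg_of_compactSpace_chartedSpace (lieAlg hS) _ _ _ G _ _ _ cs 1⟩

end MatrixLie

end Literature.RepresentationTheory.CompactGroups
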